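import Mathlib.Algebra.Polynomial.Div
import Mathlib.Algebra.Polynomial.Degree.TrailingDegree
import Mathlib.Algebra.Polynomial.Eval.Coeff
import Literature.Computability.AlgebraicComplexity.SchoenhageTauBini
import Literature.Computability.AlgebraicComplexity.BorderRankRestriction
import HarnessLib

/-!
# Border substitution with torus degenerations, at the level of approximate decompositions — proved

Topic `Literature/Computability/AlgebraicComplexity`.  Theorems only (plus the data definition
`zeroSlice`).  This file makes the ITERATED "border substitution method" of Landsberg–Michałek
(IMRN 2018 = arXiv:1608.07486, §2, Prop. 2.3 and §3 Part 1: substitution, then "by the torus action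
and Lemma 2.2 … using the Borel action we can move the entry") available for the tree's ALGEBRAIC
border rank `algBorderRank` over `K[ε]` (`SchoenhageTau.lean`, Bläser 2013, Def. 6.1), in a
completely explicit form that needs neither Grassmannians nor the Borel fixed point theorem nor the
Zariski-closedness of `{bR ≤ k}` (Alder's theorem).  The invariant one-shot form of the
substitution step (Landsberg 2017, Prop. 5.4.1.3: some `a₀ ≠ 0` works for every projection killing
it) is the sibling `BorderSubstitution.lean` (`exists_ne_zero_algBorderRank_restrict₁_le`); the
point of the present file is that the group action, the torus limit and the substitution must be
performed on ONE AND THE SAME approximate decomposition (the normalising moves of LM §3 Part 1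
change which coordinate vector the leading coefficient degenerates to), so every statement here
is about a given decomposition `(u, v, w)` and the leading data of one of its first-factor vectors:

* `IsApproxDecomposition.polyMatrix₁` — acting on the first factor of an approximate decomposition
  by a matrix with POLYNOMIAL entries `G(ε)` gives an approximate decomposition of `G(0)·t`.
* `IsApproxDecomposition.dropTriad_zeroSlice` — if one first-factor vector vanishes off the
  coordinate `α`, dropping that triad leaves a decomposition of `t` with the slice `α` zeroed.
* `IsApproxDecomposition.substitutionStep` — **the one-step border substitution**: if the
  first-factor vector `u_{ρ₀}(ε)` of an order-`h` decomposition with `r + 1` triads has the shape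
  `u_{ρ₀} = εˢ (c e_α + ε ·)`, `c ≠ 0`, then the tensor `t` with slice `α` zeroed (i.e. `t` reduced
  modulo `e_α` in the first factor, LM's `T/â`) has an order-`h` decomposition with `r` triads
  (apply `G(ε) : e_a ↦ c⁻¹θ e_a (a ≠ α), e_α ↦ e_α − ε c⁻¹ ∑ A_a e_a`, which maps `u_{ρ₀}` into
  `K[ε] e_α` and is the identity at `ε = 0`, then drop the triad).
* `IsApproxDecomposition.torus` — **torus degenerations inside `K[ε]`**: if `t` is homogeneous of
  weight `e` for weights `ωA, ωB, ωC ∈ ℕ` on the coordinates, substituting `ε = δ^q` (`q > e`) and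
  multiplying every coordinate by `δ^ω` turns an order-`h` decomposition into an order-`qh + e` one
  (this replaces "act by the torus and pass to the limit", LM Lemma 2.2 + §3 Part 1).
* `exists_leadingData` — every non-zero `U ∈ K[ε]^ι` is `εˢ (lc + ε R)` with `lc ≠ 0`.
* `exists_isApproxDecomposition_zeroSlice` / `algBorderRank_zeroSlice_le` — **the step of LM §3,
  Part 1**: from a decomposition of `t` with `r + 1` triads, an exact stabilizer `(A, B, C)` of `t`
  (constant matrices) and weights making `t` homogeneous, if `β` is the strict weight-minimum of the
  support of `A · lc` (`lc` the leading coefficient vector of some `u_{ρ₀}`), then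
  `bR(t with slice β zeroed) ≤ r`.

All statements are over a field `K`; index types are finite with decidable equality where sums or
updates require it.

## References

* J. M. Landsberg, M. Michałek, *A `2n² − log₂(n) − 1` lower bound for the border rank of matrix
  multiplication*, IMRN 2018 (15) 4722–4733, arXiv:1608.07486 — §2 (Def. 2.1, Lemma 2.2,
  Prop. 2.3), §3 Part 1. [LandsbergMichalek2018]
* M. Bläser, *Fast Matrix Multiplication*, Theory of Computing Graduate Surveys 5 (2013), Def. 6.1
  (`R_h`, border rank over `K[ε]`). [Blaser2013]
-/

noncomputable section

open scoped BigOperators Polynomial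
open Polynomial

namespace Literature.Computability.AlgebraicComplexity

universe u v₁ v₂ v₃ v₄

variable {K : Type u} [Field K] {ι : Type v₁} {κ : Type v₂} {μ : Type v₃} {ι' : Type v₄}

/-! ## Zeroing a slice of the first factor -/

/-- `t` with the slice `a = α` of the first factor replaced by `0`: in coordinates adapted to
`e_α`, this is the image of `t` in `(A/⟨e_α⟩) ⊗ B ⊗ C` (Landsberg–Michałek's `T/â`, Def. 2.1),
padded by a zero slice so as to keep the index type. [cite: LandsbergMichalek2018, Def. 2.1] -/
def zeroSlice [DecidableEq ι] (t : ι → κ → μ → K) (α : ι) : ι → κ → μ → K :=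
  fun a b c => if a = α then 0 else t a b c

/-- Unfolding lemma for `zeroSlice`. [cite: LandsbergMichalek2018, Def. 2.1] -/
@[simp] theorem zeroSlice_apply [DecidableEq ι] (t : ι → κ → μ → K) (α a : ι) (b : κ) (c : μ) :
    zeroSlice t α a b c = if a = α then 0 else t a b c := rfl

/-! ## Polynomial matrices acting on the first factor -/

section PolyMatrix

variable [Fintype ι]

/-- Acting on the first factor of an order-`h` approximate decomposition of `t` by a matrix `G`
with entries in `K[ε]` yields an order-`h` approximate decomposition of `G(0) · t` (only the
constant terms `g = G(0)` of the entries matter for the limit). [cite: LandsbergMichalek2018, §2 (proof of Prop. 2.3)] -/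
theorem IsApproxDecomposition.polyMatrix₁ {h : ℕ} {t : ι → κ → μ → K} {r : ℕ}
    {u : Fin r → ι → K[X]} {v : Fin r → κ → K[X]} {w : Fin r → μ → K[X]}
    (H : IsApproxDecomposition h t u v w) (G : ι' → ι → K[X]) (g : ι' → ι → K)
    (hg : ∀ a' a, (G a' a).coeff 0 = g a' a) :
    IsApproxDecomposition h (fun a' b c => ∑ a, g a' a * t a b c)
      (fun ρ a' => ∑ a, G a' a * u ρ a) v w := by
  rw [isApproxDecomposition_iff] at H ⊢
  intro a' b c
  choose Q hQ hQ0 using H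
  refine ⟨∑ a, G a' a * Q a b c, ?_, ?_⟩
  · calc ∑ ρ, (∑ a, G a' a * u ρ a) * v ρ b * w ρ c
        = ∑ a, G a' a * ∑ ρ, u ρ a * v ρ b * w ρ c := by
          simp only [Finset.sum_mul, Finset.mul_sum]
          rw [Finset.sum_comm]
          refine Finset.sum_congr rfl fun a _ => Finset.sum_congr rfl fun ρ _ => by ring
      _ = X ^ h * ∑ a, G a' a * Q a b c := by
          rw [Finset.mul_sum]
          refine Finset.sum_congr rfl fun a _ => ?_
          rw [hQ a b c]; ring
  · simp only [finsetSum_coeff, mul_coeff_zero, hg, hQ0]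

end PolyMatrix

/-! ## Dropping a triad whose first vector is concentrated on one coordinate -/

/-- If the first-factor vector `u_{ρ₀}` of an approximate decomposition of `t` vanishes at every
coordinate `a ≠ α`, then the remaining `r` triads (with the coordinate `α` of their first vectors
set to `0`) form an approximate decomposition, of the same order, of `t` with slice `α` zeroed.
[cite: LandsbergMichalek2018, §2 (proof of Prop. 2.3)] -/
theorem IsApproxDecomposition.dropTriad_zeroSlice [DecidableEq ι] {h : ℕ} {t : ι → κ → μ → K}
    {r : ℕ} {u : Fin (r + 1) → ι → K[X]} {v : Fin (r + 1) → κ → K[X]}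
    {w : Fin (r + 1) → μ → K[X]} (H : IsApproxDecomposition h t u v w) (ρ₀ : Fin (r + 1)) (α : ι)
    (hoff : ∀ a, a ≠ α → u ρ₀ a = 0) :
    IsApproxDecomposition h (zeroSlice t α)
      (fun i a => if a = α then 0 else u (ρ₀.succAbove i) a)
      (fun i => v (ρ₀.succAbove i)) (fun i => w (ρ₀.succAbove i)) := by
  intro a b c j hj
  by_cases ha : a = α
  · subst ha
    simp only [if_true, zero_mul, Finset.sum_const_zero, coeff_zero, zeroSlice_apply]
    split_ifs <;> rfl
  · simp only [if_neg ha, zeroSlice_apply]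
    have key := H a b c j hj
    rw [Fin.sum_univ_succAbove _ ρ₀, hoff a ha, zero_mul, zero_mul, zero_add] at key
    exact key

/-! ## The one-step border substitution -/

section Step

variable [Fintype ι] [DecidableEq ι]

/-- **One step of the border substitution method** (Landsberg–Michałek 2018, Prop. 2.3 with
`a' = a − 1`, made explicit over `K[ε]`): let `∑_{ρ ≤ r} u_ρ ⊗ v_ρ ⊗ w_ρ = εʰ t + O(ε^{h+1})` and
suppose the first vector of the triad `ρ₀` has the form `u_{ρ₀}(α) = εˢ θ` with `θ(0) ≠ 0` and
`ε^{s+1} ∣ u_{ρ₀}(a)` for `a ≠ α` (its leading coefficient is a non-zero multiple of `e_α`).  Then `t`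
with slice `α` zeroed — `t` reduced modulo `e_α` — has an order-`h` approximate decomposition with
only `r` triads.  Proof: apply to the first factor the polynomial matrix `G(ε)`,
`e_a ↦ c⁻¹θ e_a (a ≠ α)`, `e_α ↦ e_α − ε c⁻¹ ∑_{a ≠ α} A_a e_a` (`c = θ(0)`,
`u_{ρ₀}(a) = ε^{s+1} A_a`), which is the identity at `ε = 0` and maps `u_{ρ₀}` to `εˢ c⁻¹θ² e_α`;
then drop the triad `ρ₀`. [cite: LandsbergMichalek2018, Prop. 2.3 and §3 Part 1] -/
theorem IsApproxDecomposition.substitutionStep {h : ℕ} {t : ι → κ → μ → K} {r : ℕ}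
    {u : Fin (r + 1) → ι → K[X]} {v : Fin (r + 1) → κ → K[X]} {w : Fin (r + 1) → μ → K[X]}
    (H : IsApproxDecomposition h t u v w) (ρ₀ : Fin (r + 1)) (α : ι) (s : ℕ) (θ : K[X])
    (hθ : u ρ₀ α = X ^ s * θ) (hc : θ.coeff 0 ≠ 0) (hoff : ∀ a, a ≠ α → X ^ (s + 1) ∣ u ρ₀ a) :
    ∃ (u' : Fin r → ι → K[X]) (v' : Fin r → κ → K[X]) (w' : Fin r → μ → K[X]),
      IsApproxDecomposition h (zeroSlice t α) u' v' w' := by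
  classical
  set c := θ.coeff 0 with hcdef
  -- `u ρ₀ a = X^(s+1) * A a` for `a ≠ α`
  set A : ι → K[X] := fun a => u ρ₀ a /ₘ X ^ (s + 1) with hA
  have hAu : ∀ a, a ≠ α → X ^ (s + 1) * A a = u ρ₀ a := by
    intro a ha
    have hmod : u ρ₀ a %ₘ X ^ (s + 1) = 0 :=
      (modByMonic_eq_zero_iff_dvd (monic_X_pow (s + 1))).2 (hoff a ha)
    have := modByMonic_add_div (u ρ₀ a) (X ^ (s + 1))
    rw [hmod, zero_add] at this
    exact this
  -- the polynomial matrix `G`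
  set G : ι → ι → K[X] := fun a' a =>
    if a' = α then (if a = α then 1 else 0)
    else (if a = a' then C c⁻¹ * θ else if a = α then -(X * C c⁻¹ * A a') else 0) with hG
  have hG0 : ∀ a' a, (G a' a).coeff 0 = if a = a' then 1 else 0 := by
    intro a' a
    by_cases ha' : a' = α
    · subst ha'
      simp only [hG, if_true]
      split_ifs <;> simp
    · simp only [hG, if_neg ha']
      by_cases haa : a = a'
      · subst haa
        rw [if_pos rfl, if_pos rfl, coeff_C_mul, ← hcdef, inv_mul_cancel₀ hc]
      · rw [if_neg haa, if_neg haa]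
        split_ifs
        · simp
        · simp
  have D1 := H.polyMatrix₁ G (fun a' a => if a = a' then 1 else 0) hG0
  have ht : (fun a' b c' => ∑ a, (if a = a' then (1 : K) else 0) * t a b c') = t := by
    funext a' b c'
    simp only [ite_mul, one_mul, zero_mul, Finset.sum_ite_eq', Finset.mem_univ, if_true]
  rw [ht] at D1
  -- the new `ρ₀`-vector vanishes off `α`
  have hoff' : ∀ a', a' ≠ α → (∑ a, G a' a * u ρ₀ a) = 0 := by
    intro a' ha'
    have hsplit : ∀ a, G a' a * u ρ₀ a =
        (if a = a' then C c⁻¹ * θ * u ρ₀ a else 0) +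
          (if a = α then -(X * C c⁻¹ * A a') * u ρ₀ a else 0) := by
      intro a
      simp only [hG, if_neg ha']
      by_cases h1 : a = a'
      · subst h1
        rw [if_pos rfl, if_pos rfl, if_neg ha', add_zero]
      · rw [if_neg h1, if_neg h1, zero_add]
        split_ifs <;> simp
    rw [Finset.sum_congr rfl fun a _ => hsplit a, Finset.sum_add_distrib, Finset.sum_ite_eq',
      Finset.sum_ite_eq']
    simp only [Finset.mem_univ, if_true]
    rw [← hAu a' ha', hθ]
    ring
  exact ⟨_, _, _, D1.dropTriad_zeroSlice ρ₀ α hoff'⟩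

end Step

/-! ## Torus degenerations inside `K[ε]` -/

/-- **Torus action and passage to the limit, algebraically** (replacing Landsberg–Michałek's use of
Lemma 2.2 in §3, Part 1): let `t` be homogeneous of weight `e` for coordinate weights
`ωA, ωB, ωC ∈ ℕ` (`t_{abc} ≠ 0 ⇒ ωA a + ωB b + ωC c = e`), i.e. fixed up to the scalar `s^e` by
the one-parameter subgroup `s ↦ (s^{ωA}, s^{ωB}, s^{ωC})`.  Substituting `ε = δ^q` with `q > e` in
an order-`h` approximate decomposition and multiplying the coordinates by `δ^{ωA}, δ^{ωB}, δ^{ωC}`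
gives an order-`qh + e` approximate decomposition of the same `t` (the error term
`ε^{h+1}(…)` becomes `O(δ^{qh+q})`, and `qh + q > qh + e`). [cite: LandsbergMichalek2018, Lemma 2.2 and §3 Part 1] -/
theorem IsApproxDecomposition.torus {h : ℕ} {t : ι → κ → μ → K} {r : ℕ}
    {u : Fin r → ι → K[X]} {v : Fin r → κ → K[X]} {w : Fin r → μ → K[X]}
    (H : IsApproxDecomposition h t u v w) (ωA : ι → ℕ) (ωB : κ → ℕ) (ωC : μ → ℕ) (e : ℕ)
    (hhom : ∀ a b c, t a b c ≠ 0 → ωA a + ωB b + ωC c = e) (q : ℕ) (hq : e < q) :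
    IsApproxDecomposition (q * h + e) t
      (fun ρ a => X ^ ωA a * (u ρ a).comp (X ^ q))
      (fun ρ b => X ^ ωB b * (v ρ b).comp (X ^ q))
      (fun ρ c => X ^ ωC c * (w ρ c).comp (X ^ q)) := by
  rw [isApproxDecomposition_iff] at H ⊢
  intro a b c
  obtain ⟨Q, hQ, hQ0⟩ := H a b c
  have hsum : (∑ ρ, X ^ ωA a * (u ρ a).comp (X ^ q) * (X ^ ωB b * (v ρ b).comp (X ^ q)) *
      (X ^ ωC c * (w ρ c).comp (X ^ q))) =
      X ^ (ωA a + ωB b + ωC c) * (X ^ (q * h) * Q.comp (X ^ q)) := by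
    have hc : (∑ ρ, u ρ a * v ρ b * w ρ c).comp (X ^ q) = X ^ (q * h) * Q.comp (X ^ q) := by
      rw [hQ, mul_comp, X_pow_comp, ← pow_mul]
    rw [← hc, ← coe_compRingHom_apply, map_sum, Finset.mul_sum]
    refine Finset.sum_congr rfl fun ρ _ => ?_
    rw [map_mul, map_mul, coe_compRingHom_apply, coe_compRingHom_apply, coe_compRingHom_apply,
      pow_add, pow_add]
    ring
  rw [hsum]
  by_cases ht : t a b c = 0
  · -- `Q = X * Q₁`, and the whole term is `O(δ^{qh+q})`
    have hX : X ∣ Q := X_dvd_iff.2 (by rw [hQ0, ht])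
    obtain ⟨Q₁, rfl⟩ := hX
    refine ⟨X ^ (ωA a + ωB b + ωC c + q - e) * Q₁.comp (X ^ q), ?_, ?_⟩
    · rw [mul_comp, X_comp]
      have hexp : ωA a + ωB b + ωC c + q * h + q =
          (q * h + e) + (ωA a + ωB b + ωC c + q - e) := by omega
      calc X ^ (ωA a + ωB b + ωC c) * (X ^ (q * h) * (X ^ q * Q₁.comp (X ^ q)))
          = X ^ (ωA a + ωB b + ωC c + q * h + q) * Q₁.comp (X ^ q) := by
            rw [pow_add, pow_add]; ring
        _ = X ^ ((q * h + e) + (ωA a + ωB b + ωC c + q - e)) * Q₁.comp (X ^ q) := by rw [hexp]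
        _ = X ^ (q * h + e) * (X ^ (ωA a + ωB b + ωC c + q - e) * Q₁.comp (X ^ q)) := by
            rw [pow_add]; ring
    · rw [ht, coeff_X_pow_mul']
      have hne : ¬ (ωA a + ωB b + ωC c + q - e ≤ 0) := by omega
      rw [if_neg hne]
  · have he := hhom a b c ht
    refine ⟨Q.comp (X ^ q), ?_, ?_⟩
    · rw [he, pow_add]; ring
    · have hq0 : q ≠ 0 := by omega
      rw [coeff_zero_eq_eval_zero, eval_comp, eval_pow, eval_X, zero_pow hq0,
        ← coeff_zero_eq_eval_zero, hQ0]

/-! ## Leading data of a polynomial vector -/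

/-- Every non-zero `U ∈ K[ε]^ι` (finite `ι`) is `U = εˢ (lc + ε R)` with `lc ∈ K^ι` non-zero: `s` is
the least trailing degree of the non-zero entries and `lc` the vector of their `εˢ`-coefficients
(the point `[lc] ∈ ℙA` is the limit of `[U(ε)]` as `ε → 0`). [cite: LandsbergMichalek2018, §3 Part 1] -/
theorem exists_leadingData [Fintype ι] (U : ι → K[X]) (hU : U ≠ 0) :
    ∃ (s : ℕ) (lc : ι → K) (R : ι → K[X]),
      (∀ a, U a = X ^ s * (C (lc a) + X * R a)) ∧ lc ≠ 0 := by
  classical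
  have hne : (Finset.univ.filter fun a => U a ≠ 0).Nonempty := by
    by_contra h0
    rw [Finset.not_nonempty_iff_eq_empty, Finset.filter_eq_empty_iff] at h0
    apply hU
    funext a
    have := h0 (Finset.mem_univ a)
    simpa using this
  obtain ⟨a₀, ha₀, hmin⟩ := Finset.exists_min_image _ (fun a => (U a).natTrailingDegree) hne
  rw [Finset.mem_filter] at ha₀
  set s := (U a₀).natTrailingDegree with hs
  have hlow : ∀ a, ∀ d < s, (U a).coeff d = 0 := by
    intro a d hd
    by_cases ha : U a = 0
    · rw [ha, coeff_zero]
    · exact coeff_eq_zero_of_lt_natTrailingDegree (hd.trans_le (hmin a (by simpa using ha)))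
  have hdvd : ∀ a, X ^ s ∣ U a := fun a => X_pow_dvd_iff.2 (hlow a)
  choose V hV using hdvd
  refine ⟨s, fun a => (V a).coeff 0, fun a => (V a - C ((V a).coeff 0)) /ₘ X, ?_, ?_⟩
  · intro a
    have hX : X ∣ V a - C ((V a).coeff 0) := X_dvd_iff.2 (by simp)
    have hmod : (V a - C ((V a).coeff 0)) %ₘ X = 0 := (modByMonic_eq_zero_iff_dvd monic_X).2 hX
    have hdiv := modByMonic_add_div (V a - C ((V a).coeff 0)) X
    rw [hmod, zero_add] at hdiv
    rw [hdiv, hV a]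
    ring
  · intro hlc
    have h1 : (V a₀).coeff 0 = 0 := congrFun hlc a₀
    have h2 : (U a₀).coeff s = (V a₀).coeff 0 := by
      rw [hV a₀, coeff_X_pow_mul']
      simp
    have h3 : (U a₀).trailingCoeff = 0 := by
      unfold Polynomial.trailingCoeff
      rw [← hs, h2, h1]
    exact ha₀.2 (trailingCoeff_eq_zero.1 h3)

/-! ## The step of Landsberg–Michałek's Part 1 -/

section Master

variable [Fintype ι] [DecidableEq ι] [Fintype κ] [Fintype μ]

/-- **The inductive step of Landsberg–Michałek 2018, §3, Part 1, for the algebraic border rank.**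
Let `∑_{ρ ≤ r} u_ρ ⊗ v_ρ ⊗ w_ρ = εʰ t + O(ε^{h+1})`, let `u_{ρ₀} = εˢ (lc + ε R)`, let `(A, B, C)` be
constant matrices fixing `t` exactly (an element of the stabilizer `G_t`, applied through
`IsApproxDecomposition.restrict`), and let `t` be homogeneous for weights `ωA, ωB, ωC` (a
one-parameter subgroup of the torus of `G_t`).  If the coordinate `β` is the strict `ωA`-minimum of
the support of `A · lc`, then `t` with slice `β` zeroed (i.e. `t` reduced modulo `e_β`) has an
approximate decomposition with only `r` triads: act by `(A, B, C)`, degenerate along the torus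
(`IsApproxDecomposition.torus` with `ε = δ^q`, `q > max(e, ωA β)`), after which `u_{ρ₀}` has leading
coefficient a non-zero multiple of `e_β`, and apply the one-step substitution
(`IsApproxDecomposition.substitutionStep`).  This is LM's "by Proposition 2.3 there exists
`a ∈ 𝔅_{R̲−1}` …; by the torus action and Lemma 2.2 we may assume that `a` has just one nonzero
entry; using the Borel action we can move the entry", with the group elements made explicit.
[cite: LandsbergMichalek2018, §3 Part 1 (with Prop. 2.3, Lemma 2.2)] -/
theorem exists_isApproxDecomposition_zeroSlice {h r : ℕ} {t : ι → κ → μ → K}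
    {u : Fin (r + 1) → ι → K[X]} {v : Fin (r + 1) → κ → K[X]} {w : Fin (r + 1) → μ → K[X]}
    (H : IsApproxDecomposition h t u v w) (ρ₀ : Fin (r + 1)) (s : ℕ) (lc : ι → K) (R : ι → K[X])
    (hu : ∀ a, u ρ₀ a = X ^ s * (C (lc a) + X * R a))
    (A : ι → ι → K) (B : κ → κ → K) (Cm : μ → μ → K)
    (hstab : ∀ a' b' c', ∑ a, ∑ b, ∑ c, A a' a * B b' b * Cm c' c * t a b c = t a' b' c')
    (ωA : ι → ℕ) (ωB : κ → ℕ) (ωC : μ → ℕ) (e : ℕ)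
    (hhom : ∀ a b c, t a b c ≠ 0 → ωA a + ωB b + ωC c = e)
    (β : ι) (hβ : ∑ a, A β a * lc a ≠ 0)
    (hmin : ∀ a', a' ≠ β → ∑ a, A a' a * lc a ≠ 0 → ωA β < ωA a') :
    ∃ (h' : ℕ) (u' : Fin r → ι → K[X]) (v' : Fin r → κ → K[X]) (w' : Fin r → μ → K[X]),
      IsApproxDecomposition h' (zeroSlice t β) u' v' w' := by
  classical
  -- (1) act by the stabilizer element `(A, B, C)`
  have D1 := H.restrict A B Cm
  have ht : (fun a' b' c' => ∑ a, ∑ b, ∑ c, A a' a * B b' b * Cm c' c * t a b c) = t := by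
    funext a' b' c'
    exact hstab a' b' c'
  rw [ht] at D1
  -- leading data of the new `ρ₀`-vector: `lc₁ = A · lc`
  set lc₁ : ι → K := fun a' => ∑ a, A a' a * lc a with hlc₁
  set R₁ : ι → K[X] := fun a' => ∑ a, C (A a' a) * R a with hR₁
  have hu₁ : ∀ a', (∑ a, C (A a' a) * u ρ₀ a) = X ^ s * (C (lc₁ a') + X * R₁ a') := by
    intro a'
    have e1 : C (lc₁ a') = ∑ a, C (A a' a) * C (lc a) := by
      simp only [hlc₁, map_sum, map_mul]
    rw [e1, hR₁, Finset.mul_sum, ← Finset.sum_add_distrib, Finset.mul_sum]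
    refine Finset.sum_congr rfl fun a _ => ?_
    rw [hu a]
    ring
  -- (2) degenerate along the torus: `ε = δ^q`
  set q := max e (ωA β) + 1 with hqdef
  have hq : e < q := by rw [hqdef]; exact Nat.lt_succ_of_le (le_max_left _ _)
  have hqβ : ωA β < q := by rw [hqdef]; exact Nat.lt_succ_of_le (le_max_right _ _)
  have D2 := D1.torus ωA ωB ωC e hhom q hq
  -- (3) the `ρ₀`-vector now has leading coefficient `lc₁ β • e_β`
  set u₂ : Fin (r + 1) → ι → K[X] :=
    fun ρ a' => X ^ ωA a' * (∑ a, C (A a' a) * u ρ a).comp (X ^ q) with hu₂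
  set s' := q * s + ωA β with hs'
  set θ : K[X] := C (lc₁ β) + X ^ q * (R₁ β).comp (X ^ q) with hθ
  have hshape : ∀ a', u₂ ρ₀ a' =
      X ^ (q * s + ωA a') * (C (lc₁ a') + X ^ q * (R₁ a').comp (X ^ q)) := by
    intro a'
    show X ^ ωA a' * (∑ a, C (A a' a) * u ρ₀ a).comp (X ^ q) = _
    rw [hu₁ a', mul_comp, X_pow_comp, ← pow_mul, add_comp, C_comp, mul_comp, X_comp, pow_add]
    ring
  have hθβ : u₂ ρ₀ β = X ^ s' * θ := hshape β
  have hθ0 : θ.coeff 0 ≠ 0 := by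
    have hq0 : ¬ (q ≤ 0) := by omega
    rw [hθ, coeff_add, coeff_C_zero, coeff_X_pow_mul', if_neg hq0, add_zero]
    exact hβ
  have hoff : ∀ a', a' ≠ β → X ^ (s' + 1) ∣ u₂ ρ₀ a' := by
    intro a' ha'
    rw [hshape a']
    by_cases hl : lc₁ a' = 0
    · rw [hl, map_zero, zero_add, ← mul_assoc, ← pow_add]
      exact Dvd.dvd.mul_right (pow_dvd_pow X (by omega)) _
    · have hlt := hmin a' ha' hl
      exact Dvd.dvd.mul_right (pow_dvd_pow X (by omega)) _
  exact ⟨q * h + e, D2.substitutionStep ρ₀ β s' θ hθβ hθ0 hoff⟩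

/-- **Border-rank form of the step**: under the hypotheses of
`exists_isApproxDecomposition_zeroSlice` (a decomposition of `t` with `r + 1` triads, an exact
stabilizer move and torus weights singling out `β`), `bR(t with slice β zeroed) ≤ r`; with
`r + 1 = bR(t)` this is LM's `R̲(T/ê_β) ≤ R̲(T) − 1`. [cite: LandsbergMichalek2018, §3 Part 1] -/
theorem algBorderRank_zeroSlice_le [DecidableEq κ] [DecidableEq μ] {h r : ℕ} {t : ι → κ → μ → K}
    {u : Fin (r + 1) → ι → K[X]} {v : Fin (r + 1) → κ → K[X]} {w : Fin (r + 1) → μ → K[X]}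
    (H : IsApproxDecomposition h t u v w) (ρ₀ : Fin (r + 1)) (s : ℕ) (lc : ι → K) (R : ι → K[X])
    (hu : ∀ a, u ρ₀ a = X ^ s * (C (lc a) + X * R a))
    (A : ι → ι → K) (B : κ → κ → K) (Cm : μ → μ → K)
    (hstab : ∀ a' b' c', ∑ a, ∑ b, ∑ c, A a' a * B b' b * Cm c' c * t a b c = t a' b' c')
    (ωA : ι → ℕ) (ωB : κ → ℕ) (ωC : μ → ℕ) (e : ℕ)
    (hhom : ∀ a b c, t a b c ≠ 0 → ωA a + ωB b + ωC c = e)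
    (β : ι) (hβ : ∑ a, A β a * lc a ≠ 0)
    (hmin : ∀ a', a' ≠ β → ∑ a, A a' a * lc a ≠ 0 → ωA β < ωA a') :
    algBorderRank (zeroSlice t β) ≤ r := by
  obtain ⟨h', u', v', w', D⟩ := exists_isApproxDecomposition_zeroSlice H ρ₀ s lc R hu A B Cm
    hstab ωA ωB ωC e hhom β hβ hmin
  exact (algBorderRank_le_approxRank h' _).trans (approxRank_le_of_isApproxDecomposition D)

end Master

end Literature.Computability.AlgebraicComplexity

end
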